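import Summits.MatrixMultiplication.MatrixMultiplication.Theorems.FarEdgeDescentContactAtoms
import Mathlib.Analysis.Convex.Deriv
import HarnessLib

/-!
# Route `FarEdgeDescent` — the dichotomy lens at the NEAR vertex, I: corner vs tangential departure at the dual exponent `α`

Support module (def-free) for the asides `SmoothProfile` (stmt-MatrixMultiplication-27850) and `TameProfile`
(stmt-MatrixMultiplication-31917) and the special crux `FiniteSaturation` (stmt-MatrixMultiplication-23739) of
`Summits/MatrixMultiplication/MatrixMultiplication/Theses/FarEdgeDescent.lean`.  The cut of record
`ω(ℂ) = 2 ⟺ FiniteSaturation ∧ AnchoredLogConvexity` (`FarEdgeDescentChord.node_iff`) and its deciding theorem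
`closes` are UNCHANGED; this file and Part II (`FarEdgeDescentNearEdgeCut`) run the lineage's «special vs generic»
dichotomy at the OTHER end of the same convex profile `f(x) = ω(1,x,1)` (tree `omegaRect ℂ 1 x 1`): the NEAR
vertex `x = α = dualExponentAlpha ℂ` (`f ≡ 2` exactly on `(-∞, α]`, `α = 1 ⟺ ω = 2`, tree
`dualExponentAlpha_eq_one_iff`), where gen 22 had recorded «a second observable needs new Literature» — it does
not: everything below is proved from BUILT tree modules.

* §0 THE PROFILE ON THE WHOLE LINE.  `f ≡ 2` on `(-∞, α] ⊇ (-∞, 0]` and `f` is convex on ALL of `ℝ`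
  (`profile_convexOn_univ`: the tree's convexity on `[0,∞)`, Lotti–Romani, glued to the constant `2` through
  monotonicity), so Mathlib's one-sided-derivative API for convex functions applies at `α` WITHOUT knowing `α > 0`.
* §1 NEAR-VERTEX CALCULUS.  Left derivative `∂⁻f(α) = 0` (`leftDeriv_alpha`); the right derivative
  `κ₀ := ∂⁺f(α) ∈ [0, 1]` exists (`hasRightDerivAt`, `rightDeriv_alpha_nonneg`, `rightDeriv_alpha_le_one`) and its
  line SUPPORTS the profile globally, `f(x) ≥ 2 + κ₀ (x − α)` (`support_line`); NEAR CONTACT-ANGLE PRICE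
  `κ₀ (1 − α) ≤ ω − 2` (`rightDeriv_price`); `f` is differentiable at `α` iff `κ₀ = 0` (`differentiableAt_alpha_iff`).
* §2 ★ THE NEAR-VERTEX DICHOTOMY (hypothesis-free exhaustion, `not_mm_iff_corner_or_tangential`): `ω(ℂ) > 2` iff
  EXACTLY ONE of (N2) CORNER DEPARTURE — `α < 1` and a line through `(α, 2)` of positive slope supports `f`
  (`⟺ α < 1 ∧ κ₀ > 0`, `corner_iff_rightDeriv_pos`); (N3) TANGENTIAL DEPARTURE — `α < 1` and `f` differentiable at
  `α`.  Exclusive (`corner_tangential_exclusive`); corner price `s (1 − α) ≤ ω − 2` (`corner_price`).  There is NO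
  ROUND near atom: `f(0) = 2` is a theorem (`near_floor_touched`), and `α > 0` (`alpha_pos_iff`; Coppersmith 1982,
  tree `coppersmith1982_dualExponentAlpha_gt` in `Coppersmith1982RapidRectangular`, not imported here; numerically
  the named fact `vxxz2024_alpha_ge`, `alpha_pos_of_vxxz`) — contrast the far edge, whose round world
  `¬FiniteSaturation` is open.  Part II builds the exact regularity cut `ω = 2 ⟺ NearTame ∧ NearSmooth` on this.

Placement [cite: LottiRomani1983, §1 (p. 173), Prop. 4.1] [cite: LeGall2012, §1 (the dual exponent α)]
[cite: VassilevskaWilliamsXuXuZhou2024, §1 (α = 1 iff ω = 2; α ≥ 0.321334)] [cite: Coppersmith1982, Theorem]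
[cite: Rockafellar1970, Thm. 24.1].
Written by the decomp-mm lens-2 planner seat (gen 23); imports only BUILT modules; no new definitions.
-/

set_option linter.dupNamespace false

noncomputable section

namespace Summit.MatrixMultiplication.MatrixMultiplication.Theorems.FarEdgeDescentNearVertex

open Literature.Computability.AlgebraicComplexity
open Summit.MatrixMultiplication.MatrixMultiplication.Theses.FarEdgeDescent
open Summit.MatrixMultiplication.MatrixMultiplication.Theorems.FarEdgeDescentChord
open Filter Topology Set

/-! ## §0 The profile on the whole line -/

/-- `f(x) = 2` for every `x ≤ α` (tree). -/
theorem profile_eq_two_of_le_alpha {x : ℝ} (hx : x ≤ dualExponentAlpha ℂ) : omegaRect ℂ 1 x 1 = 2 :=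
  omegaRect_eq_two_of_le_dualExponentAlpha ℂ hx

/-- `f(x) = 2` for every `x ≤ 0` (as `0 ≤ α`). -/
theorem profile_eq_two_of_nonpos {x : ℝ} (hx : x ≤ 0) : omegaRect ℂ 1 x 1 = 2 :=
  profile_eq_two_of_le_alpha (hx.trans (dualExponentAlpha_nonneg ℂ))

/-- `f(x) > 2` for every `x > α` (tree). -/
theorem two_lt_profile_of_alpha_lt {x : ℝ} (hx : dualExponentAlpha ℂ < x) : 2 < omegaRect ℂ 1 x 1 :=
  two_lt_omegaRect_of_dualExponentAlpha_lt ℂ hx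

/-- `ω(ℂ) > 2 ⟺ α < 1` (from `ω(ℂ) = 2 ⟺ α = 1`, VXXZ §1: tree `dualExponentAlpha_eq_one_iff`, landed under
`Summits/` as `CharacteristicContinuityTransferThreshold.matrixMultiplication_iff_dualExponentAlpha_eq_one` — that
module is not imported here to keep this file out of another route's Theses cone). -/
theorem not_mm_iff_alpha_lt_one : ¬ _root_.MatrixMultiplication ↔ dualExponentAlpha ℂ < 1 := by
  rw [_root_.MatrixMultiplication_iff, ← dualExponentAlpha_eq_one_iff ℂ]
  exact ⟨fun h => lt_of_le_of_ne (dualExponentAlpha_le_one ℂ) h, fun h => ne_of_lt h⟩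

/-- ★ **Global convexity.**  The profile `x ↦ ω(1,x,1)` is convex on the WHOLE real line: convex on `[0,∞)`
(Lotti–Romani, tree `omegaRect_convexOn_one_mid_one`), constant `= 2` on `(-∞, 0]`, and monotone. -/
theorem profile_convexOn_univ : ConvexOn ℝ univ (fun y : ℝ => omegaRect ℂ 1 y 1) := by
  refine convexOn_of_slope_mono_adjacent convex_univ ?_
  intro x y z _ _ hxy hyz
  rcases le_or_gt 0 x with hx | hx
  · exact (omegaRect_convexOn_one_mid_one ℂ).slope_mono_adjacent (mem_Ici.2 hx)
      (mem_Ici.2 (by linarith)) hxy hyz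
  · have hfx : omegaRect ℂ 1 x 1 = 2 := profile_eq_two_of_nonpos hx.le
    rcases le_or_gt y 0 with hy | hy
    · have hfy : omegaRect ℂ 1 y 1 = 2 := profile_eq_two_of_nonpos hy
      have hmono : omegaRect ℂ 1 y 1 ≤ omegaRect ℂ 1 z 1 := omegaRect_one_mid_one_mono ℂ hyz.le
      rw [hfx, hfy, sub_self, zero_div]
      exact div_nonneg (by linarith) (by linarith)
    · have h0 : omegaRect ℂ 1 (0 : ℝ) 1 = 2 := omegaRect_one_zero_one ℂ
      have hconv := (omegaRect_convexOn_one_mid_one ℂ).slope_mono_adjacent (x := 0) (y := y) (z := z)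
        (mem_Ici.2 le_rfl) (mem_Ici.2 (by linarith)) hy hyz
      rw [h0, sub_zero] at hconv
      have h2y : 2 ≤ omegaRect ℂ 1 y 1 := two_le_omegaRect_one_mid_one ℂ y
      calc (omegaRect ℂ 1 y 1 - omegaRect ℂ 1 x 1) / (y - x)
          = (omegaRect ℂ 1 y 1 - 2) / (y - x) := by rw [hfx]
        _ ≤ (omegaRect ℂ 1 y 1 - 2) / y := div_le_div_of_nonneg_left (by linarith) hy (by linarith)
        _ ≤ (omegaRect ℂ 1 z 1 - omegaRect ℂ 1 y 1) / (z - y) := hconv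

/-- Every real is an interior point of the convexity domain `univ`. -/
theorem mem_interior_univ (b : ℝ) : b ∈ interior (univ : Set ℝ) := by simp

/-! ## §1 Near-vertex calculus: one-sided derivatives at `α`, support line, price -/

/-- The RIGHT DERIVATIVE `∂⁺f(b) := derivWithin f (Ioi b) b` exists at every real shape `b`. -/
theorem hasRightDerivAt (b : ℝ) :
    HasDerivWithinAt (fun y : ℝ => omegaRect ℂ 1 y 1)
      (derivWithin (fun y : ℝ => omegaRect ℂ 1 y 1) (Ioi b) b) (Ioi b) b :=
  profile_convexOn_univ.hasDerivWithinAt_rightDeriv_of_mem_interior (mem_interior_univ b)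

/-- The LEFT DERIVATIVE `∂⁻f(b) := derivWithin f (Iio b) b` exists at every real shape `b`. -/
theorem hasLeftDerivAt (b : ℝ) :
    HasDerivWithinAt (fun y : ℝ => omegaRect ℂ 1 y 1)
      (derivWithin (fun y : ℝ => omegaRect ℂ 1 y 1) (Iio b) b) (Iio b) b :=
  profile_convexOn_univ.hasDerivWithinAt_leftDeriv_of_mem_interior (mem_interior_univ b)

/-- At the near vertex the left derivative is `0`: `f ≡ 2` on `(-∞, α]`. -/
theorem hasLeftDerivAt_alpha_zero :
    HasDerivWithinAt (fun y : ℝ => omegaRect ℂ 1 y 1) 0 (Iio (dualExponentAlpha ℂ)) (dualExponentAlpha ℂ) := by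
  have h1 : HasDerivWithinAt (fun _ : ℝ => (2 : ℝ)) 0 (Iio (dualExponentAlpha ℂ)) (dualExponentAlpha ℂ) :=
    hasDerivWithinAt_const _ _ _
  refine h1.congr_of_eventuallyEq ?_ ?_
  · filter_upwards [self_mem_nhdsWithin] with y hy
    exact profile_eq_two_of_le_alpha (le_of_lt hy)
  · exact omegaRect_dualExponentAlpha ℂ

/-- `∂⁻f(α) = 0`. -/
theorem leftDeriv_alpha :
    derivWithin (fun y : ℝ => omegaRect ℂ 1 y 1) (Iio (dualExponentAlpha ℂ)) (dualExponentAlpha ℂ) = 0 :=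
  hasLeftDerivAt_alpha_zero.derivWithin (uniqueDiffWithinAt_Iio _)

/-- `0 ≤ κ₀ := ∂⁺f(α)` (left derivative `0 ≤` right derivative, convexity). -/
theorem rightDeriv_alpha_nonneg :
    0 ≤ derivWithin (fun y : ℝ => omegaRect ℂ 1 y 1) (Ioi (dualExponentAlpha ℂ)) (dualExponentAlpha ℂ) := by
  have h := profile_convexOn_univ.leftDeriv_le_rightDeriv_of_mem_interior
    (mem_interior_univ (dualExponentAlpha ℂ))
  rwa [leftDeriv_alpha] at h

/-- The right derivative at `b` is below every secant slope to the right of `b`. -/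
theorem rightDeriv_le_slope {b y : ℝ} (h : b < y) :
    derivWithin (fun y : ℝ => omegaRect ℂ 1 y 1) (Ioi b) b ≤ slope (fun y : ℝ => omegaRect ℂ 1 y 1) b y :=
  profile_convexOn_univ.rightDeriv_le_slope_of_mem_interior (mem_interior_univ b) (mem_univ y) h

/-- ★ **SUPPORT LINE at the near vertex**: `2 + κ₀ (x − α) ≤ f(x)` for EVERY real `x`
(right of `α` by convexity, left of `α` because `f = 2` there and `κ₀ ≥ 0`). -/
theorem support_line (x : ℝ) :
    2 + derivWithin (fun y : ℝ => omegaRect ℂ 1 y 1) (Ioi (dualExponentAlpha ℂ)) (dualExponentAlpha ℂ) *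
        (x - dualExponentAlpha ℂ) ≤ omegaRect ℂ 1 x 1 := by
  rcases le_or_gt x (dualExponentAlpha ℂ) with hx | hx
  · rw [profile_eq_two_of_le_alpha hx]
    nlinarith [rightDeriv_alpha_nonneg, sub_nonpos.2 hx]
  · have h := rightDeriv_le_slope hx
    rw [slope_def_field, omegaRect_dualExponentAlpha, le_div_iff₀ (sub_pos.2 hx)] at h
    linarith

/-- `κ₀ ≤ 1` (the secant to `α + 1` has slope `≤ 1`, one padding step). -/
theorem rightDeriv_alpha_le_one :
    derivWithin (fun y : ℝ => omegaRect ℂ 1 y 1) (Ioi (dualExponentAlpha ℂ)) (dualExponentAlpha ℂ) ≤ 1 := by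
  have h := rightDeriv_le_slope (b := dualExponentAlpha ℂ) (y := dualExponentAlpha ℂ + 1) (by linarith)
  have hpad := omegaRect_one_mid_one_le_add ℂ (p := dualExponentAlpha ℂ + 1) (q := dualExponentAlpha ℂ)
    (by linarith)
  rw [slope_def_field, omegaRect_dualExponentAlpha] at h
  rw [omegaRect_dualExponentAlpha] at hpad
  have e : dualExponentAlpha ℂ + 1 - dualExponentAlpha ℂ = 1 := by ring
  rw [e, div_one] at h
  linarith

/-- ★ **NEAR CONTACT-ANGLE PRICE** `κ₀ (1 − α) ≤ ω − 2` (the support line evaluated at the square shape). -/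
theorem rightDeriv_price :
    derivWithin (fun y : ℝ => omegaRect ℂ 1 y 1) (Ioi (dualExponentAlpha ℂ)) (dualExponentAlpha ℂ) *
        (1 - dualExponentAlpha ℂ) ≤ omega ℂ - 2 := by
  have h := support_line 1
  rw [omegaRect_one_one_one] at h
  linarith

/-- If `f` is differentiable at `α` its derivative there is `0` (it equals the left derivative). -/
theorem hasDerivAt_zero_of_differentiableAt_alpha
    (hd : DifferentiableAt ℝ (fun y : ℝ => omegaRect ℂ 1 y 1) (dualExponentAlpha ℂ)) :
    HasDerivAt (fun y : ℝ => omegaRect ℂ 1 y 1) 0 (dualExponentAlpha ℂ) := by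
  have h := hd.hasDerivAt
  have e : deriv (fun y : ℝ => omegaRect ℂ 1 y 1) (dualExponentAlpha ℂ) = 0 :=
    UniqueDiffWithinAt.eq_deriv _ (uniqueDiffWithinAt_Iio _) h.hasDerivWithinAt hasLeftDerivAt_alpha_zero
  rwa [e] at h

/-- … so the right secant slopes at `α` tend to `0`. -/
theorem slope_tendsto_zero_of_differentiableAt_alpha
    (hd : DifferentiableAt ℝ (fun y : ℝ => omegaRect ℂ 1 y 1) (dualExponentAlpha ℂ)) :
    Tendsto (slope (fun y : ℝ => omegaRect ℂ 1 y 1) (dualExponentAlpha ℂ))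
      (𝓝[>] (dualExponentAlpha ℂ)) (𝓝 0) :=
  (hasDerivWithinAt_iff_tendsto_slope' self_notMem_Ioi).1
    (hasDerivAt_zero_of_differentiableAt_alpha hd).hasDerivWithinAt

/-- If `f` is differentiable at `α`, no line through `(α, 2)` of positive slope supports `f` just to the right of
`α`: a support `2 + s (m − α) ≤ f(m)` for `m ↓ α` forces `s ≤ 0`. -/
theorem slope_nonpos_of_support (hd : DifferentiableAt ℝ (fun y : ℝ => omegaRect ℂ 1 y 1) (dualExponentAlpha ℂ))
    {s : ℝ} (h : ∀ᶠ m in 𝓝[>] (dualExponentAlpha ℂ), 2 + s * (m - dualExponentAlpha ℂ) ≤ omegaRect ℂ 1 m 1) :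
    s ≤ 0 := by
  refine ge_of_tendsto (slope_tendsto_zero_of_differentiableAt_alpha hd) ?_
  filter_upwards [h, self_mem_nhdsWithin] with m hm hαm
  rw [mem_Ioi] at hαm
  rw [slope_def_field, omegaRect_dualExponentAlpha, le_div_iff₀ (sub_pos.2 hαm)]
  linarith

/-- ★ **Differentiability criterion at the near vertex**: `f` is differentiable at `α` iff `κ₀ = 0`. -/
theorem differentiableAt_alpha_iff :
    DifferentiableAt ℝ (fun y : ℝ => omegaRect ℂ 1 y 1) (dualExponentAlpha ℂ) ↔
      derivWithin (fun y : ℝ => omegaRect ℂ 1 y 1) (Ioi (dualExponentAlpha ℂ)) (dualExponentAlpha ℂ) = 0 := by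
  constructor
  · intro hd
    exact UniqueDiffWithinAt.eq_deriv _ (uniqueDiffWithinAt_Ioi _) (hasRightDerivAt _)
      (hasDerivAt_zero_of_differentiableAt_alpha hd).hasDerivWithinAt
  · intro hκ
    have hr := hasRightDerivAt (dualExponentAlpha ℂ)
    rw [hκ] at hr
    have h : HasDerivAt (fun y : ℝ => omegaRect ℂ 1 y 1) 0 (dualExponentAlpha ℂ) := by
      rw [hasDerivAt_iff_tendsto_slope, ← nhdsLT_sup_nhdsGT]
      exact ((hasDerivWithinAt_iff_tendsto_slope' self_notMem_Iio).1 hasLeftDerivAt_alpha_zero).sup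
        ((hasDerivWithinAt_iff_tendsto_slope' self_notMem_Ioi).1 hr)
    exact h.differentiableAt

/-! ## §2 ★ The near-vertex dichotomy: corner departure vs tangential departure -/

/-- The CORNER atom in derivative form: `(α < 1 ∧ a positive-slope line through (α,2) supports f) ⟺ (α < 1 ∧ κ₀ > 0)`. -/
theorem corner_iff_rightDeriv_pos :
    (dualExponentAlpha ℂ < 1 ∧ ∃ s : ℝ, 0 < s ∧
        ∀ x : ℝ, 2 + s * (x - dualExponentAlpha ℂ) ≤ omegaRect ℂ 1 x 1) ↔
      (dualExponentAlpha ℂ < 1 ∧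
        0 < derivWithin (fun y : ℝ => omegaRect ℂ 1 y 1) (Ioi (dualExponentAlpha ℂ)) (dualExponentAlpha ℂ)) := by
  constructor
  · rintro ⟨hα, s, hs, hsup⟩
    refine ⟨hα, lt_of_lt_of_le hs ?_⟩
    refine ge_of_tendsto ((hasDerivWithinAt_iff_tendsto_slope' self_notMem_Ioi).1
      (hasRightDerivAt (dualExponentAlpha ℂ))) ?_
    filter_upwards [self_mem_nhdsWithin] with m hαm
    rw [mem_Ioi] at hαm
    rw [slope_def_field, omegaRect_dualExponentAlpha, le_div_iff₀ (sub_pos.2 hαm)]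
    have := hsup m
    linarith
  · rintro ⟨hα, hκ⟩
    exact ⟨hα, _, hκ, support_line⟩

/-- ★ **NEAR-VERTEX DICHOTOMY (exhaustion).**  `ω(ℂ) > 2` iff the profile leaves the information floor `2` at
`α < 1` EITHER with a corner (N2: a positive-slope support line through `(α, 2)`) OR tangentially (N3: `f`
differentiable at `α`). -/
theorem not_mm_iff_corner_or_tangential :
    ¬ _root_.MatrixMultiplication ↔
      (dualExponentAlpha ℂ < 1 ∧ ∃ s : ℝ, 0 < s ∧
          ∀ x : ℝ, 2 + s * (x - dualExponentAlpha ℂ) ≤ omegaRect ℂ 1 x 1) ∨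
      (dualExponentAlpha ℂ < 1 ∧
          DifferentiableAt ℝ (fun y : ℝ => omegaRect ℂ 1 y 1) (dualExponentAlpha ℂ)) := by
  rw [not_mm_iff_alpha_lt_one]
  constructor
  · intro hα
    rcases rightDeriv_alpha_nonneg.lt_or_eq with hpos | hzero
    · exact Or.inl (corner_iff_rightDeriv_pos.2 ⟨hα, hpos⟩)
    · exact Or.inr ⟨hα, differentiableAt_alpha_iff.2 hzero.symm⟩
  · rintro (⟨hα, -⟩ | ⟨hα, -⟩) <;> exact hα

/-- Exclusivity (N2)/(N3): a corner at `α` is not a point of differentiability. -/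
theorem corner_tangential_exclusive
    (hC : dualExponentAlpha ℂ < 1 ∧ ∃ s : ℝ, 0 < s ∧
      ∀ x : ℝ, 2 + s * (x - dualExponentAlpha ℂ) ≤ omegaRect ℂ 1 x 1) :
    ¬ (dualExponentAlpha ℂ < 1 ∧
        DifferentiableAt ℝ (fun y : ℝ => omegaRect ℂ 1 y 1) (dualExponentAlpha ℂ)) := by
  rintro ⟨-, hd⟩
  obtain ⟨-, s, hs, hsup⟩ := hC
  have h := slope_nonpos_of_support hd (s := s) (Eventually.of_forall fun m => hsup m)
  linarith

/-- Each near atom forces `ω > 2` (corner). -/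
theorem not_mm_of_corner
    (hC : dualExponentAlpha ℂ < 1 ∧ ∃ s : ℝ, 0 < s ∧
      ∀ x : ℝ, 2 + s * (x - dualExponentAlpha ℂ) ≤ omegaRect ℂ 1 x 1) :
    ¬ _root_.MatrixMultiplication :=
  not_mm_iff_corner_or_tangential.2 (Or.inl hC)

/-- Each near atom forces `ω > 2` (tangential). -/
theorem not_mm_of_tangential
    (hT : dualExponentAlpha ℂ < 1 ∧
      DifferentiableAt ℝ (fun y : ℝ => omegaRect ℂ 1 y 1) (dualExponentAlpha ℂ)) :
    ¬ _root_.MatrixMultiplication :=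
  not_mm_iff_corner_or_tangential.2 (Or.inr hT)

/-- CORNER PRICE: a corner of slope `s` at `α` costs `s (1 − α) ≤ ω − 2` — near corners are either blunt or
close to the square shape. -/
theorem corner_price {s : ℝ}
    (hsup : ∀ x : ℝ, 2 + s * (x - dualExponentAlpha ℂ) ≤ omegaRect ℂ 1 x 1) :
    s * (1 - dualExponentAlpha ℂ) ≤ omega ℂ - 2 := by
  have h := hsup 1
  rw [omegaRect_one_one_one] at h
  linarith

/-- NO ROUND NEAR ATOM, I: the floor is touched (`f(0) = 2`, indeed `f = 2` on `[0, α]`), so the near analogue of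
the far edge's round world `e > 0 on [1,∞)` is refuted outright. -/
theorem near_floor_touched : ∃ x : ℝ, 0 ≤ x ∧ x ≤ 1 ∧ omegaRect ℂ 1 x 1 = 2 :=
  ⟨0, le_rfl, zero_le_one, omegaRect_one_zero_one ℂ⟩

/-- NO ROUND NEAR ATOM, II: `α > 0 ⟺` the floor is touched at a positive shape; the right-hand side is
Coppersmith's 1982 theorem (`⟨n, n^{0.17}, n⟩` in `n^{2+o(1)}`; tree `coppersmith1982_dualExponentAlpha_gt`,
not imported) and, numerically stronger, the named fact `vxxz2024_alpha_ge` (`α ≥ 0.321334`). -/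
theorem alpha_pos_iff : 0 < dualExponentAlpha ℂ ↔ ∃ x : ℝ, 0 < x ∧ omegaRect ℂ 1 x 1 = 2 := by
  constructor
  · exact fun h => ⟨_, h, omegaRect_dualExponentAlpha ℂ⟩
  · rintro ⟨x, hx, h⟩
    exact lt_of_lt_of_le hx (le_dualExponentAlpha_of_omegaRect_eq_two ℂ h)

/-- Discharge of `α > 0` by the named fact `vxxz2024_alpha_ge` (VXXZ 2024, Table 1). -/
theorem alpha_pos_of_vxxz (h : vxxz2024_alpha_ge) : 0 < dualExponentAlpha ℂ := by
  have h1 : omegaRect ℂ 1 (0.321334 : ℝ) 1 = 2 := h.omegaRect_eq_two le_rfl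
  have h2 := le_dualExponentAlpha_of_omegaRect_eq_two ℂ h1
  linarith

end Summit.MatrixMultiplication.MatrixMultiplication.Theorems.FarEdgeDescentNearVertex

end
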